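import Summits.KontsevichZagierPeriods.Zeta5Search.LaiSweepShard

/-!
# `κ₃` sweep certificate — shard file 034 of 127 (shards 238–244 of 889)

HONEST FRAMING. Systematic search; no irrationality claim unless certified. This file only checks,
by `decide +kernel`, shards 238–244 of the order-cell sweep of the `κ₃` point `(74, 2180, 444; δ74)`
(engine `LaiSweepEngine`, soundness `LaiSweepJump/Free/Eval/Shard/Kappa3`; a shard is `⟨regime, n,
p, q, p', q', Lo, Up⟩`: `n` cells from `p/q` to `p'/q'` with integer rate sums in `[Lo, Up]`, `K =
128`, `D = 2^40`). It draws NO conclusion: only the capstone `LaiKappa3SweepCert`, which needs all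
127 shard files, does. Kernel cost of this file ≈ 560 cells × 0.3 s.
-/

namespace Summit.KontsevichZagierPeriods.Zeta5Search.Sweep

set_option maxHeartbeats 100000000 in
/-- Shard 238: 80 cells of regime B from `56/309` to `877/4804`.
[cite: Lai2024BallRivoal, §4 Lemma 4.3] -/
theorem shard238 :
    Shard.check 128 (2^40)
      ⟨true, 80, 56, 309, 877, 4804, 37804595903369, 38668776129819⟩ = true := by
  decide +kernel

set_option maxHeartbeats 100000000 in
/-- Shard 239: 80 cells of regime B from `877/4804` to `59/321`.
[cite: Lai2024BallRivoal, §4 Lemma 4.3] -/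
theorem shard239 :
    Shard.check 128 (2^40)
      ⟨true, 80, 877, 4804, 59, 321, 35215606387264, 36029736559707⟩ = true := by
  decide +kernel

set_option maxHeartbeats 100000000 in
/-- Shard 240: 80 cells of regime B from `59/321` to `47/254`.
[cite: Lai2024BallRivoal, §4 Lemma 4.3] -/
theorem shard240 :
    Shard.check 128 (2^40)
      ⟨true, 80, 59, 321, 47, 254, 34904611674669, 35724097277923⟩ = true := by
  decide +kernel

set_option maxHeartbeats 100000000 in
/-- Shard 241: 80 cells of regime B from `47/254` to `895/4804`.
[cite: Lai2024BallRivoal, §4 Lemma 4.3] -/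
theorem shard241 :
    Shard.check 128 (2^40)
      ⟨true, 80, 47, 254, 895, 4804, 35334558260658, 36178459279234⟩ = true := by
  decide +kernel

set_option maxHeartbeats 100000000 in
/-- Shard 242: 80 cells of regime B from `895/4804` to `76/405`.
[cite: Lai2024BallRivoal, §4 Lemma 4.3] -/
theorem shard242 :
    Shard.check 128 (2^40)
      ⟨true, 80, 895, 4804, 76, 405, 37528078920673, 38440840277592⟩ = true := by
  decide +kernel

set_option maxHeartbeats 100000000 in
/-- Shard 243: 80 cells of regime B from `76/405` to `71/376`.
[cite: Lai2024BallRivoal, §4 Lemma 4.3] -/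
theorem shard243 :
    Shard.check 128 (2^40)
      ⟨true, 80, 76, 405, 71, 376, 32423510879733, 33221247873571⟩ = true := by
  decide +kernel

set_option maxHeartbeats 100000000 in
/-- Shard 244: 80 cells of regime B from `71/376` to `65/342`.
[cite: Lai2024BallRivoal, §4 Lemma 4.3] -/
theorem shard244 :
    Shard.check 128 (2^40)
      ⟨true, 80, 71, 376, 65, 342, 33726987127847, 34569355874984⟩ = true := by
  decide +kernel

/-- The checked shards of this file, in order. [folklore] -/
def shards034 : List (CheckedShard 128 (2^40)) :=
  [⟨_, shard238⟩, ⟨_, shard239⟩, ⟨_, shard240⟩, ⟨_, shard241⟩, ⟨_, shard242⟩,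
    ⟨_, shard243⟩, ⟨_, shard244⟩]

end Summit.KontsevichZagierPeriods.Zeta5Search.Sweep
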